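import Mathlib
import Literature.NumberTheory.LFunctions.LiouvilleSumClassicalBound
import HarnessLib

/-!
# `TypeIIToLevel` (route `LiouvilleMAD`), part 4a: the type-I sums of a class weight are `λ`-sums on progressions

Support file for the item stmt-Parity-14996
(`Summit.Parity.GeneralizedHardyLittlewood.Theses.LiouvilleMAD.TypeIIToLevel`).

The Vaughan engine (`LiouvilleMADTypeIIToLevelEngine`) consumes, for the class weight
`lam(k) = 1[k ≡ w (q)] λ(k + h)`, bounds for the type-I sums `P = ∑_{m ≤ t} lam(dm)`.  Here:

* `sum_typeI_eq_zero_or`: `P` is either `0` or the `λ`-sum over the integers `n ∈ (h, dt + h]` in ONE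
  residue class modulo `r = lcm(d, q)` (the solutions `m` of `dm ≡ w (q)` make `n = dm + h` run through a
  class mod `d` and a class mod `q`);
* `abs_sum_Ioc_filter_modEq_le`, `abs_sum_Ioc_filter_modEq_le'`: a `λ`-sum over one class mod `r` in an
  integer interval `(lo, hi]`, `hi ≤ X`, is at most `2(G + 1)` whenever `G` bounds the sums
  `∑_{j ≤ J} λ(rj + c)` (`0 ≤ c < r`, `J ≤ X/r`) — the inner sums of the tree theorem `BVLiouville`;
* `abs_sum_typeI_le`: hence `|P| ≤ 2(G + 1)` with `G` the Bombieri–Vinogradov datum at the modulus `lcm(d,q)`.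
-/

noncomputable section

open Finset Real ArithmeticFunction
open Literature.NumberTheory.LFunctions.LiouvilleSum (abs_liouville_le_one)

namespace Summit.Parity.GeneralizedHardyLittlewood.Theorems.TypeIIToLevel

/-! ### `λ`-sums over one class in an integer interval -/

/-- `λ(toNat n) = 0` for `n ≤ 0`. [folklore] -/
theorem liouville_toNat_of_nonpos {n : ℤ} (hn : n ≤ 0) : (liouville (Int.toNat n) : ℝ) = 0 := by
  rw [Int.toNat_of_nonpos hn, ArithmeticFunction.map_zero, Int.cast_zero]

/-- **One class in `(0, Y]`**: if `G` bounds `|∑_{j ≤ J} λ(rj + c)|` for all `0 ≤ c < r`, `J ≤ X/r`, then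
for `Y ≤ X` the `λ`-sum over `{0 < n ≤ Y : n ≡ c₀ (r)}` is at most `G + 1` (the class is
`{c, c + r, c + 2r, …}` with `c = c₀ mod r`; the point `c` costs `1`). [folklore] -/
theorem abs_sum_Ioc_filter_modEq_le {r : ℕ} (hr : 0 < r) (c₀ : ℤ) {X : ℕ} {G : ℝ}
    (hG : ∀ c J : ℕ, c < r → J ≤ X / r →
      |∑ j ∈ Icc 1 J, (liouville (Int.toNat ((r : ℤ) * j + c)) : ℝ)| ≤ G)
    {Y : ℤ} (hY : Y ≤ X) :
    |∑ n ∈ (Ioc (0 : ℤ) Y).filter (fun n => n ≡ c₀ [ZMOD r]), (liouville (Int.toNat n) : ℝ)| ≤ G + 1 := by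
  have hr0 : (r : ℤ) ≠ 0 := by exact_mod_cast hr.ne'
  have hrpos : (0 : ℤ) < r := by exact_mod_cast hr
  -- the reduced residue
  set c : ℕ := (c₀ % r).toNat with hc
  have hcc : (c : ℤ) = c₀ % r := Int.toNat_of_nonneg (Int.emod_nonneg _ hr0)
  have hcr : c < r := by
    have : (c : ℤ) < r := by rw [hcc]; exact Int.emod_lt_of_pos _ hrpos
    exact_mod_cast this
  have hmem : ∀ n : ℤ, n ≡ c₀ [ZMOD r] ↔ n % r = c := by
    intro n; rw [Int.ModEq, hcc]
  -- the progression `j ↦ rj + c`, `1 ≤ j ≤ J`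
  set J : ℕ := ((Y - c) / r).toNat with hJ
  set A := (Ioc (0 : ℤ) Y).filter (fun n => n ≡ c₀ [ZMOD r]) with hA
  set B := (Icc 1 J).image (fun j : ℕ => (r : ℤ) * j + c) with hB
  have hBA : B ⊆ A := by
    intro n hn
    obtain ⟨j, hj, rfl⟩ := mem_image.1 hn
    rw [mem_Icc] at hj
    have hJ1 : 1 ≤ J := hj.1.trans hj.2
    have hJpos : (0 : ℤ) < (Y - c) / r := by
      by_contra hneg
      push Not at hneg
      have : J = 0 := by rw [hJ]; exact Int.toNat_of_nonpos hneg
      omega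
    have hJeq : (J : ℤ) = (Y - c) / r := Int.toNat_of_nonneg hJpos.le
    have hjJ : (j : ℤ) ≤ (Y - c) / r := by rw [← hJeq]; exact_mod_cast hj.2
    have hmul : (r : ℤ) * ((Y - c) / r) ≤ Y - c := Int.mul_ediv_self_le hr0
    rw [hA, mem_filter, mem_Ioc]
    refine ⟨⟨?_, ?_⟩, ?_⟩
    · have : (1 : ℤ) ≤ j := by exact_mod_cast hj.1
      nlinarith
    · nlinarith
    · rw [hmem, add_comm, Int.add_mul_emod_self_left, Int.emod_eq_of_lt (by positivity) (by exact_mod_cast hcr)]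
  have hdiff : A \ B ⊆ {(c : ℤ)} := by
    intro n hn
    rw [mem_sdiff, hA, mem_filter, mem_Ioc] at hn
    obtain ⟨⟨⟨hn0, hnY⟩, hnc⟩, hnB⟩ := hn
    rw [hmem] at hnc
    rw [mem_singleton]
    have hdecomp : (r : ℤ) * (n / r) + c = n := by rw [← hnc]; exact Int.mul_ediv_add_emod n r
    have hj0 : 0 ≤ n / r := Int.ediv_nonneg hn0.le hrpos.le
    rcases hj0.lt_or_eq with hjpos | hj0'
    · -- then `n ∈ B`, contradiction
      exfalso
      apply hnB
      rw [hB, mem_image]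
      refine ⟨(n / r).toNat, mem_Icc.2 ⟨?_, ?_⟩, ?_⟩
      · have : (1 : ℤ) ≤ n / r := hjpos
        exact_mod_cast (show ((1 : ℕ) : ℤ) ≤ ((n / r).toNat : ℤ) by
          rw [Int.toNat_of_nonneg hj0]; exact_mod_cast this)
      · have hle : n / r ≤ (Y - c) / r := by
          apply Int.le_ediv_of_mul_le hrpos
          linarith [hdecomp]
        have : ((n / r).toNat : ℤ) ≤ (J : ℤ) := by
          rw [Int.toNat_of_nonneg hj0, hJ, Int.toNat_of_nonneg (hjpos.le.trans hle)]
          exact hle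
        exact_mod_cast this
      · rw [Int.toNat_of_nonneg hj0]
        exact hdecomp
    · rw [← hdecomp, ← hj0', mul_zero, zero_add]
  -- sum over `A` = sum over `B` + at most one point
  have hsplit := sum_sdiff hBA (f := fun n => (liouville (Int.toNat n) : ℝ))
  have hsmall : |∑ n ∈ A \ B, (liouville (Int.toNat n) : ℝ)| ≤ 1 := by
    refine (abs_sum_le_sum_abs _ _).trans ?_
    calc ∑ n ∈ A \ B, |(liouville (Int.toNat n) : ℝ)| ≤ ∑ _n ∈ A \ B, (1 : ℝ) :=
          sum_le_sum fun n _ => abs_liouville_le_one _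
      _ = #(A \ B) := by simp
      _ ≤ #({(c : ℤ)} : Finset ℤ) := by exact_mod_cast card_le_card hdiff
      _ = 1 := by simp
  have hsumB : ∑ n ∈ B, (liouville (Int.toNat n) : ℝ) =
      ∑ j ∈ Icc 1 J, (liouville (Int.toNat ((r : ℤ) * j + c)) : ℝ) := by
    rw [hB, sum_image]
    intro j₁ _ j₂ _ h
    have : (r : ℤ) * j₁ = (r : ℤ) * j₂ := by linarith
    exact_mod_cast mul_left_cancel₀ hr0 this
  have hJX : J ≤ X / r := by
    rw [hJ]
    have h1 : (Y - c) / r ≤ (X : ℤ) / r := Int.ediv_le_ediv hrpos (by linarith [(Nat.cast_nonneg c : (0 : ℤ) ≤ c)])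
    have h2 : ((X / r : ℕ) : ℤ) = (X : ℤ) / r := Int.natCast_div X r
    exact Int.toNat_le.2 (by rw [h2]; exact h1)
  rw [← hsplit, hsumB]
  calc |∑ n ∈ A \ B, (liouville (Int.toNat n) : ℝ) + ∑ j ∈ Icc 1 J, (liouville (Int.toNat ((r : ℤ) * j + c)) : ℝ)|
      ≤ |∑ n ∈ A \ B, (liouville (Int.toNat n) : ℝ)| + |∑ j ∈ Icc 1 J, (liouville (Int.toNat ((r : ℤ) * j + c)) : ℝ)| :=
        abs_add_le _ _
    _ ≤ 1 + G := add_le_add hsmall (hG c J hcr hJX)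
    _ = G + 1 := by ring

/-- **One class in `(lo, hi]`**: under the same hypothesis, for ALL integers `lo` and `hi ≤ X` the
`λ`-sum over `{lo < n ≤ hi : n ≡ c₀ (r)}` is at most `2(G + 1)` (the terms `n ≤ 0` vanish, and
`(max(lo,0), hi]` is a difference of two initial intervals). [folklore] -/
theorem abs_sum_Ioc_filter_modEq_le' {r : ℕ} (hr : 0 < r) (c₀ : ℤ) {X : ℕ} {G : ℝ}
    (hG : ∀ c J : ℕ, c < r → J ≤ X / r →
      |∑ j ∈ Icc 1 J, (liouville (Int.toNat ((r : ℤ) * j + c)) : ℝ)| ≤ G)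
    {lo hi : ℤ} (hhi : hi ≤ X) :
    |∑ n ∈ (Ioc lo hi).filter (fun n => n ≡ c₀ [ZMOD r]), (liouville (Int.toNat n) : ℝ)| ≤ 2 * (G + 1) := by
  have hG0 : 0 ≤ G := le_trans (abs_nonneg _) (hG 0 0 hr (Nat.zero_le _))
  set a : ℤ := max lo 0 with ha
  -- drop the terms `n ≤ 0`
  have hdrop : ∑ n ∈ (Ioc lo hi).filter (fun n => n ≡ c₀ [ZMOD r]), (liouville (Int.toNat n) : ℝ) =
      ∑ n ∈ (Ioc a hi).filter (fun n => n ≡ c₀ [ZMOD r]), (liouville (Int.toNat n) : ℝ) := by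
    symm
    refine sum_subset (filter_subset_filter _ (Ioc_subset_Ioc_left (le_max_left lo 0))) ?_
    intro n hn hn'
    rw [mem_filter, mem_Ioc] at hn
    have hn0 : n ≤ 0 := by
      by_contra hpos
      push Not at hpos
      exact hn' (mem_filter.2 ⟨mem_Ioc.2 ⟨max_lt hn.1.1 hpos, hn.1.2⟩, hn.2⟩)
    exact liouville_toNat_of_nonpos hn0
  rw [hdrop]
  rcases le_or_gt hi a with hhia | hahi
  · rw [Finset.Ioc_eq_empty (not_lt.2 hhia), filter_empty, sum_empty, abs_zero]; positivity
  · have ha0 : 0 ≤ a := le_max_right _ _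
    have hunion : (Ioc 0 hi).filter (fun n => n ≡ c₀ [ZMOD r]) =
        (Ioc 0 a).filter (fun n => n ≡ c₀ [ZMOD r]) ∪ (Ioc a hi).filter (fun n => n ≡ c₀ [ZMOD r]) := by
      rw [← filter_union, Finset.Ioc_union_Ioc_eq_Ioc ha0 hahi.le]
    have hdisj : Disjoint ((Ioc 0 a).filter (fun n => n ≡ c₀ [ZMOD r]))
        ((Ioc a hi).filter (fun n => n ≡ c₀ [ZMOD r])) := by
      rw [Finset.disjoint_left]
      intro n h1 h2
      rw [mem_filter, mem_Ioc] at h1 h2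
      omega
    have heq : ∑ n ∈ (Ioc a hi).filter (fun n => n ≡ c₀ [ZMOD r]), (liouville (Int.toNat n) : ℝ) =
        ∑ n ∈ (Ioc 0 hi).filter (fun n => n ≡ c₀ [ZMOD r]), (liouville (Int.toNat n) : ℝ) -
          ∑ n ∈ (Ioc 0 a).filter (fun n => n ≡ c₀ [ZMOD r]), (liouville (Int.toNat n) : ℝ) := by
      rw [hunion, sum_union hdisj]; ring
    rw [heq]
    have h1 := abs_sum_Ioc_filter_modEq_le hr c₀ hG hhi
    have h2 := abs_sum_Ioc_filter_modEq_le hr c₀ hG (hahi.le.trans hhi)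
    calc _ ≤ |∑ n ∈ (Ioc 0 hi).filter (fun n => n ≡ c₀ [ZMOD r]), (liouville (Int.toNat n) : ℝ)| +
          |∑ n ∈ (Ioc 0 a).filter (fun n => n ≡ c₀ [ZMOD r]), (liouville (Int.toNat n) : ℝ)| := abs_sub _ _
      _ ≤ (G + 1) + (G + 1) := add_le_add h1 h2
      _ = 2 * (G + 1) := by ring

/-! ### The type-I sums of the class weight -/

/-- **Structure of a type-I sum of the class weight**: for `d ≥ 1`,
`∑_{m ≤ t} 1[dm ≡ w (q)] λ(dm + h)` is either `0` (no solution of `dm ≡ w`) or the `λ`-sum over the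
integers `n ∈ (h, dt + h]` in one residue class modulo `lcm(d, q)` (if `m₀` is a solution, the solutions
are exactly the `m` with `dm + h ≡ dm₀ + h` both mod `d` and mod `q`). [folklore] -/
theorem sum_typeI_eq_zero_or {d q : ℕ} (hd : 0 < d) (w : ℕ) (h : ℤ) (t : ℕ) :
    (∑ m ∈ Ioc 0 t, (if d * m ≡ w [MOD q] then (liouville (Int.toNat (((d * m : ℕ) : ℤ) + h)) : ℝ) else 0)) = 0 ∨
    ∃ c₀ : ℤ, ∑ m ∈ Ioc 0 t, (if d * m ≡ w [MOD q] then (liouville (Int.toNat (((d * m : ℕ) : ℤ) + h)) : ℝ) else 0) =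
      ∑ n ∈ (Ioc h (((d * t : ℕ) : ℤ) + h)).filter (fun n => n ≡ c₀ [ZMOD (Nat.lcm d q)]),
        (liouville (Int.toNat n) : ℝ) := by
  set T := (Ioc 0 t).filter (fun m => d * m ≡ w [MOD q]) with hT
  have hP : ∑ m ∈ Ioc 0 t, (if d * m ≡ w [MOD q] then (liouville (Int.toNat (((d * m : ℕ) : ℤ) + h)) : ℝ) else 0) =
      ∑ m ∈ T, (liouville (Int.toNat (((d * m : ℕ) : ℤ) + h)) : ℝ) := by
    rw [hT, sum_filter]
  rw [hP]
  rcases T.eq_empty_or_nonempty with hTe | ⟨m₀, hm₀⟩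
  · left; rw [hTe, sum_empty]
  · right
    have hm₀' := hm₀
    rw [hT, mem_filter, mem_Ioc] at hm₀'
    obtain ⟨⟨hm₀0, hm₀t⟩, hm₀w⟩ := hm₀'
    set r := Nat.lcm d q with hr
    set c₀ : ℤ := ((d * m₀ : ℕ) : ℤ) + h with hc₀
    refine ⟨c₀, ?_⟩
    have hd0 : (d : ℤ) ≠ 0 := by exact_mod_cast hd.ne'
    have hdpos : (0 : ℤ) < d := by exact_mod_cast hd
    have hdr : (d : ℤ) ∣ r := by exact_mod_cast Nat.dvd_lcm_left d q
    have hqr : (q : ℤ) ∣ r := by exact_mod_cast Nat.dvd_lcm_right d q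
    have hlcm : (((d : ℤ).lcm (q : ℤ) : ℕ) : ℤ) = (r : ℤ) := by
      rw [Int.lcm_def, Int.natAbs_natCast, Int.natAbs_natCast]
    set A := (Ioc h (((d * t : ℕ) : ℤ) + h)).filter (fun n => n ≡ c₀ [ZMOD r]) with hA
    refine sum_nbij' (fun m : ℕ => ((d * m : ℕ) : ℤ) + h) (fun n : ℤ => ((n - h) / d).toNat) ?_ ?_ ?_ ?_
      (fun m _ => rfl)
    · -- into `A`
      intro m hm
      rw [hT, mem_filter, mem_Ioc] at hm
      obtain ⟨⟨hm0, hmt⟩, hmw⟩ := hm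
      rw [hA, mem_filter, mem_Ioc]
      refine ⟨⟨?_, ?_⟩, ?_⟩
      · have : (1 : ℤ) ≤ ((d * m : ℕ) : ℤ) := by exact_mod_cast Nat.mul_pos hd hm0
        linarith
      · have : ((d * m : ℕ) : ℤ) ≤ ((d * t : ℕ) : ℤ) := by exact_mod_cast Nat.mul_le_mul_left d hmt
        linarith
      · -- mod `d` and mod `q`, hence mod `lcm`
        have h1 : ((d * m : ℕ) : ℤ) + h ≡ c₀ [ZMOD d] := by
          rw [Int.modEq_iff_dvd, hc₀]
          refine ⟨(m₀ : ℤ) - m, ?_⟩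
          push_cast; ring
        have h2 : ((d * m : ℕ) : ℤ) + h ≡ c₀ [ZMOD q] := by
          rw [hc₀]
          exact Int.ModEq.add_right h (Int.natCast_modEq_iff.2 (hmw.trans hm₀w.symm))
        have h12 := Int.modEq_and_modEq_iff_modEq_lcm.1 ⟨h1, h2⟩
        rwa [hlcm] at h12
    · -- back into `T`
      intro n hn
      rw [hA, mem_filter, mem_Ioc] at hn
      obtain ⟨⟨hnh, hnt⟩, hnc⟩ := hn
      have hnd : n ≡ c₀ [ZMOD d] := Int.ModEq.of_dvd hdr hnc
      have hnq : n ≡ c₀ [ZMOD q] := Int.ModEq.of_dvd hqr hnc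
      have hdvd : (d : ℤ) ∣ n - h := by
        have := (Int.modEq_iff_dvd.1 hnd.symm)
        -- `d ∣ n - c₀` and `d ∣ c₀ - h`
        have h2 : (d : ℤ) ∣ c₀ - h := ⟨m₀, by rw [hc₀]; push_cast; ring⟩
        have := Int.dvd_add this h2
        convert this using 1; ring
      set k : ℤ := (n - h) / d with hk
      have hkn : (d : ℤ) * k = n - h := Int.mul_ediv_cancel' hdvd
      have hk1 : 1 ≤ k := by
        by_contra hlt
        push Not at hlt
        have : (d : ℤ) * k ≤ 0 := by nlinarith
        linarith
      have hkt : k ≤ t := by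
        by_contra hlt
        push Not at hlt
        have h1 : (d : ℤ) * (t + 1) ≤ (d : ℤ) * k := by nlinarith
        have h2 : ((d * t : ℕ) : ℤ) = (d : ℤ) * t := by push_cast; ring
        linarith
      have hk0 : 0 ≤ k := by linarith
      have hkcast : ((k.toNat : ℕ) : ℤ) = k := Int.toNat_of_nonneg hk0
      rw [hT, mem_filter, mem_Ioc]
      refine ⟨⟨by omega, by omega⟩, ?_⟩
      -- `d m ≡ d m₀ ≡ w (mod q)`
      have hmod : (((d * k.toNat : ℕ) : ℤ)) ≡ ((d * m₀ : ℕ) : ℤ) [ZMOD q] := by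
        have e1 : ((d * k.toNat : ℕ) : ℤ) = n - h := by push_cast; rw [hkcast, hkn]
        have e2 : ((d * m₀ : ℕ) : ℤ) = c₀ - h := by rw [hc₀]; ring
        rw [e1, e2]
        exact Int.ModEq.sub_right h hnq
      exact (Int.natCast_modEq_iff.1 hmod).trans hm₀w
    · -- left inverse
      intro m _
      have : (((d * m : ℕ) : ℤ) + h - h) / d = m := by
        rw [add_sub_cancel_right]; push_cast; rw [mul_comm]; exact Int.mul_ediv_cancel _ hd0
      rw [this, Int.toNat_natCast]
    · -- right inverse
      intro n hn
      rw [hA, mem_filter, mem_Ioc] at hn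
      obtain ⟨⟨hnh, _⟩, hnc⟩ := hn
      have hnd : n ≡ c₀ [ZMOD d] := Int.ModEq.of_dvd hdr hnc
      have hdvd : (d : ℤ) ∣ n - h := by
        have h1 := (Int.modEq_iff_dvd.1 hnd.symm)
        have h2 : (d : ℤ) ∣ c₀ - h := ⟨m₀, by rw [hc₀]; push_cast; ring⟩
        have := Int.dvd_add h1 h2
        convert this using 1; ring
      have hkn : (d : ℤ) * ((n - h) / d) = n - h := Int.mul_ediv_cancel' hdvd
      have hk0 : 0 ≤ (n - h) / d := by
        by_contra hlt
        push Not at hlt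
        have : (d : ℤ) * ((n - h) / d) < 0 := by nlinarith
        linarith
      push_cast
      rw [Int.toNat_of_nonneg hk0, hkn]; ring

/-- **The type-I sums of the class weight are controlled by Bombieri–Vinogradov data at the modulus
`lcm(d, q)`**: if `G` bounds `|∑_{j ≤ J} λ(rj + c)|` for `r = lcm(d,q)`, all `0 ≤ c < r` and `J ≤ X/r`, then
`|∑_{m ≤ t} 1[dm ≡ w (q)] λ(dm + h)| ≤ 2(G + 1)` whenever `dt + h ≤ X`. [folklore] -/
theorem abs_sum_typeI_le {d q : ℕ} (hd : 0 < d) (hq : 0 < q) (w : ℕ) (h : ℤ) {t X : ℕ}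
    (hX : ((d * t : ℕ) : ℤ) + h ≤ X) {G : ℝ}
    (hG : ∀ c J : ℕ, c < Nat.lcm d q → J ≤ X / Nat.lcm d q →
      |∑ j ∈ Icc 1 J, (liouville (Int.toNat ((Nat.lcm d q : ℤ) * j + c)) : ℝ)| ≤ G) :
    |∑ m ∈ Ioc 0 t, (if d * m ≡ w [MOD q] then (liouville (Int.toNat (((d * m : ℕ) : ℤ) + h)) : ℝ) else 0)| ≤
      2 * (G + 1) := by
  have hr : 0 < Nat.lcm d q := Nat.lcm_pos hd hq
  have hG0 : 0 ≤ G := le_trans (abs_nonneg _) (hG 0 0 hr (Nat.zero_le _))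
  rcases sum_typeI_eq_zero_or (q := q) hd w h t with h0 | ⟨c₀, hc₀⟩
  · rw [h0, abs_zero]; positivity
  · rw [hc₀]
    exact abs_sum_Ioc_filter_modEq_le' hr c₀ hG hX

end Summit.Parity.GeneralizedHardyLittlewood.Theorems.TypeIIToLevel

end
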